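import Literature.MathematicalPhysics.QuantumFieldTheory.Balaban1983to89.Beta.ExpKernelCalculus
import Literature.MathematicalPhysics.QuantumFieldTheory.Balaban1983to89.B12Beta

/-!
# `BalabanUV.Beta.KernelPermutation` — road «FP» for binder row D1, row PERM-COV (owner rows of H2-DESIGN, R-FP-15 risk (R3)), MODULE 1:
# THE AXIS-PERMUTATION TWIN OF `Beta.KernelReflection` — permutations of the lattice axes act on matrix-fibred kernels by relabelling
# sites AND leg types; composition, trace, bubble, tadpole are invariant (unconditionally), and the resolvent Hessian kernel of
# permutation-covariant ingredients is `B12Beta.PermCovariant`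

HONEST FRAMING (cell contract, verbatim): «discharging `BetaPertH` makes Bałaban's UV stability UNCONDITIONAL — a real constructive-QFT
result; it is NOT the continuum limit and NOT the Clay problem.»  THIS MODULE DISCHARGES NOTHING of `BetaPertH` / row D1: it is [folklore]
transport of structure for the abstract resolvent Hessian kernel `ExpKernelCalculus.hessKer A V W`, the `Equiv.Perm (Fin D)` twin of
`Beta.KernelReflection` §1–§4 (an2).  WHY A NEW RELABELLING: `KernelReflection.refK Φ K x z a b := s_a s_b K (r_a x) (r_b z) a b` keeps the LEG
TYPE `a` fixed (a reflection maps a `κ`-bond to a `κ`-bond); a permutation `σ` of the axes maps a `κ`-bond to a `σ κ`-bond and a `κ`-multiplier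
leg to a `σ κ`-multiplier leg, so the leg type must be relabelled too: `permK Ψ K x z a b := K (r x) (r z) (π a) (π b)` for a site bijection `r`
and a leg-type bijection `π` (no signs).  USE (road FP owner's `LEAVES-FP.md` sub-row PERM-COV under N7/H2-OBJ): the hyperoctahedral letters of
the H2-G germ argument (`MarginalUniqueness.cubic_unique`: `PermInvariant` + `FlipInvariant`) need, next to the reflection rows already in the
tree (`ResolventReflection`, `KernelReflection`, `WilsonJetReflection`, `RootedJetReflection`), the PERMUTATION rows; this is their kernel algebra.
MODULE 2 (`Beta.ResolventPermutation`) transports the typed `U = 1` KKT system and proves `permK (axisPerm σ) (KInv N) = KInv N`,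
`permK (axisPerm σ) (KInvStep Lc j) = KInvStep Lc j`; MODULE 3 the `TbalOf` law from jet covariance.

CONVENTION (= `B12Beta.PermCovariant`, (1.21) p. 264 of [B12] as typed there): `σ` acts on lattice vectors by `x ↦ x ∘ σ⁻¹` (`psite σ`,
so `(σ•x)_{σ i} = x_i` and `σ•e_κ = e_{σ κ}`) and on directions / leg types by `κ ↦ σ κ`.

CONTENT ([folklore], 0 sorry, 0 `def … : Prop`, nothing cited):
* §1 `psite σ : (Fin D → β) ≃ (Fin D → β)` and its algebra (additive, `ℓ¹`-isometric: `l1_psite`).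
* §2 `LegPerm D F` (a site bijection + a leg-type bijection), `permK`; **`comp_permK`**, **`tr_permK`**, `bubble_permK`, `tadpole_permK` —
  UNCONDITIONAL (re-indexing a `tsum` by an `Equiv` and a finite sum by a permutation needs no summability, unlike the signed `refK` case);
  `permK` is linear; decay / bi-localisation transport (`decays_permK`, `biLoc_permK`) for `ℓ¹`-isometric site maps.
* §3 **`hessKer_perm`**: if `permK Ψ A = A`, `V (τ μ) (ρ y) = permK Ψ (V μ y)`, `W (τ μ) (ρ y) (τ ν) (ρ y') = permK Ψ (W μ y ν y')` for a direction
  map `τ` and a base-point map `ρ` with `ρ 0 = 0`, then `hessKer A V W (τ μ) (τ ν) (ρ z) = hessKer A V W μ ν z` — no decay, no block covariance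
  needed (the permutation fixes the base point `0`, unlike the reflection `bref α μ 0 ≠ 0` of `KernelReflection.hessKer_refl`).
* §4 the AXIS-PERMUTATION LEG MAP `axisPerm σ : LegPerm (d+1) (Fin (d+1) ⊕ Fin (d+1))` (sites by `psite σ`, field AND multiplier legs by `σ`),
  `shiftK_permK_axisPerm`, decay transport, and **`permCovariant_hessKer`** / **`permCovariant_flip_hessKer`**: `B12Beta.PermCovariant` of
  `hessKer A V W` (and of its flip `z ↦ −z`) from the three covariances, for every `σ`.
Unit `b2b-balaban-beta-d1-formalise-leaf-01` (gen 7), 2026-08-20; claim table `HOME/b2b-balaban-beta-d1-p3/LEAVES-FP.md` sub-row PERM-COV.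
HONEST DEPENDENCY (verbatim): «continuum YM on T⁴ ⇐ BetaPertH ∧ nine spine estimates (0/9 proved); BetaPertH ⇐ (D1) ∧ (D4) ∧ CAP+tail;
G-an2-4 gates asym, D1 and NE2/3/4.»  ABSOLUTE RULE (cell, verbatim): «No internally-minted statement may enter as a cited fact. Every
hypothesis is either kernel-proved in this package or a verbatim quotation of a PUBLISHED theorem with page reference.»
-/

open Finset
open scoped BigOperators
open Literature.MathematicalPhysics.QuantumFieldTheory.Balaban1983to89
open Literature.MathematicalPhysics.QuantumFieldTheory.Balaban1983to89.Beta
open B12Sec2to5 (l1)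
open B12Beta (PermCovariant)
open ExpKernelCalculus (Site MKer Decays BiLoc comp tr bubble tadpole hessKer shiftK)

namespace Summit.QuantumFields.BalabanUV.Beta.KernelPermutation

noncomputable section

variable {D : ℕ}

/-! ## §1 The axis permutation acting on lattice vectors -/

section Site

variable {β : Type*}

/-- [folklore] **THE ACTION OF AN AXIS PERMUTATION ON LATTICE VECTORS**: `psite σ x := x ∘ σ⁻¹`, i.e. `(psite σ x) (σ i) = x i` — the
coordinate `i` of `x` becomes the coordinate `σ i` (so `psite σ e_κ = e_{σ κ}`); as an `Equiv` (inverse `x ↦ x ∘ σ`). -/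
def psite (σ : Equiv.Perm (Fin D)) : (Fin D → β) ≃ (Fin D → β) where
  toFun x := fun i => x (σ.symm i)
  invFun x := fun i => x (σ i)
  left_inv x := by funext i; simp only [Equiv.symm_apply_apply]
  right_inv x := by funext i; simp only [Equiv.apply_symm_apply]

/-- [folklore] Coordinates of the permuted vector. -/
@[simp] theorem psite_apply (σ : Equiv.Perm (Fin D)) (x : Fin D → β) (i : Fin D) : psite σ x i = x (σ.symm i) := rfl

/-- [folklore] `psite σ x = x ∘ σ⁻¹` — the convention of `B12Beta.PermCovariant`. -/
theorem psite_eq_comp (σ : Equiv.Perm (Fin D)) (x : Fin D → β) : psite σ x = x ∘ σ.symm := rfl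

/-- [folklore] Coordinates of the inverse action. -/
@[simp] theorem psite_symm_apply (σ : Equiv.Perm (Fin D)) (x : Fin D → β) (i : Fin D) : (psite σ).symm x i = x (σ i) := rfl

/-- [folklore] The inverse action is the action of the inverse permutation. -/
theorem psite_symm_apply_eq (σ : Equiv.Perm (Fin D)) (x : Fin D → β) : (psite σ).symm x = psite σ⁻¹ x := by
  funext i; rfl

/-- [folklore] `psite σ⁻¹` undoes `psite σ`. -/
@[simp] theorem psite_inv_psite (σ : Equiv.Perm (Fin D)) (x : Fin D → β) : psite σ⁻¹ (psite σ x) = x := by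
  funext i; simp [psite_apply, Equiv.Perm.inv_def]

/-- [folklore] `psite σ` undoes `psite σ⁻¹`. -/
@[simp] theorem psite_psite_inv (σ : Equiv.Perm (Fin D)) (x : Fin D → β) : psite σ (psite σ⁻¹ x) = x := by
  funext i; simp [psite_apply, Equiv.Perm.inv_def]

/-- [folklore] The identity permutation acts trivially. -/
@[simp] theorem psite_one (x : Fin D → β) : psite (1 : Equiv.Perm (Fin D)) x = x := rfl

/-- [folklore] The action is additive. -/
theorem psite_add [Add β] (σ : Equiv.Perm (Fin D)) (x y : Fin D → β) : psite σ (x + y) = psite σ x + psite σ y := rfl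

/-- [folklore] The action on a difference. -/
theorem psite_sub [Sub β] (σ : Equiv.Perm (Fin D)) (x y : Fin D → β) : psite σ (x - y) = psite σ x - psite σ y := rfl

/-- [folklore] The action on a negative. -/
theorem psite_neg [Neg β] (σ : Equiv.Perm (Fin D)) (x : Fin D → β) : psite σ (-x) = -psite σ x := rfl

/-- [folklore] The action fixes the origin. -/
@[simp] theorem psite_zero [Zero β] (σ : Equiv.Perm (Fin D)) : psite σ (0 : Fin D → β) = 0 := rfl

/-- [folklore] Only the origin is mapped to the origin. -/
theorem psite_eq_zero_iff [Zero β] (σ : Equiv.Perm (Fin D)) (x : Fin D → β) : psite σ x = 0 ↔ x = 0 := by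
  constructor
  · intro h
    have h' := congrArg (psite σ⁻¹) h
    rwa [psite_inv_psite, psite_zero] at h'
  · intro h
    rw [h, psite_zero]

/-- [folklore] The action commutes with scalars. -/
theorem psite_smul {γ : Type*} [SMul γ β] (σ : Equiv.Perm (Fin D)) (c : γ) (x : Fin D → β) : psite σ (c • x) = c • psite σ x := rfl

/-- [folklore] A constant vector is fixed. -/
@[simp] theorem psite_const (σ : Equiv.Perm (Fin D)) (c : β) : psite σ (fun _ : Fin D => c) = fun _ => c := rfl

end Site

/-- [folklore] **THE ACTION IS AN `ℓ¹`-ISOMETRY**: `|σ•x|₁ = |x|₁`. -/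
theorem l1_psite (σ : Equiv.Perm (Fin D)) (x : Fin D → ℤ) : l1 (psite σ x) = l1 x := by
  unfold l1
  exact Equiv.sum_comp σ.symm (fun i => |((x i : ℤ) : ℝ)|)

/-- [folklore] … in the subtractive form used by the decay classes. -/
theorem l1_psite_sub (σ : Equiv.Perm (Fin D)) (x y : Fin D → ℤ) : l1 (psite σ x - psite σ y) = l1 (x - y) := by
  rw [← psite_sub, l1_psite]

/-! ## §2 Leg permutations and the relabelled kernel -/

section Generic

variable {F : Type*}

/-- [folklore] LEG-PERMUTATION DATA: a bijection `r` of the fine lattice and a bijection `π` of the fibre index type (leg types). -/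
structure LegPerm (D : ℕ) (F : Type*) where
  /-- the bijection of the fine lattice `ℤ^D` acting on the site of every leg -/
  r : (Fin D → ℤ) ≃ (Fin D → ℤ)
  /-- the bijection of the leg types -/
  π : F ≃ F

/-- [folklore] **THE RELABELLED KERNEL** `(Ψ·K)(x, z)_{ab} := K (r x, r z)_{π a, π b}` (sites AND leg types relabelled; no signs). -/
def permK (Ψ : LegPerm D F) (K : MKer D F) : MKer D F := fun x z a b => K (Ψ.r x) (Ψ.r z) (Ψ.π a) (Ψ.π b)

/-- [folklore] Entries of the relabelled kernel. -/
@[simp] theorem permK_apply (Ψ : LegPerm D F) (K : MKer D F) (x z : Fin D → ℤ) (a b : F) :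
    permK Ψ K x z a b = K (Ψ.r x) (Ψ.r z) (Ψ.π a) (Ψ.π b) := rfl

/-- [folklore] `permK` is homogeneous. -/
theorem permK_smul (Ψ : LegPerm D F) (c : ℝ) (K : MKer D F) : permK Ψ (c • K) = c • permK Ψ K := rfl

/-- [folklore] `permK` is additive. -/
theorem permK_add (Ψ : LegPerm D F) (K L : MKer D F) : permK Ψ (K + L) = permK Ψ K + permK Ψ L := rfl

/-- [folklore] `permK` on a difference. -/
theorem permK_sub (Ψ : LegPerm D F) (K L : MKer D F) : permK Ψ (K - L) = permK Ψ K - permK Ψ L := rfl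

/-- [folklore] `permK` of the zero kernel. -/
@[simp] theorem permK_zero (Ψ : LegPerm D F) : permK Ψ (0 : MKer D F) = 0 := rfl

/-- [folklore] DECAY TRANSPORT: for an `ℓ¹`-isometric site map, `permK` preserves `Decays` with the same constants. -/
theorem decays_permK {Ψ : LegPerm D F} (hr : ∀ x y : Fin D → ℤ, l1 (Ψ.r x - Ψ.r y) = l1 (x - y)) {K : MKer D F} {C δ : ℝ}
    (hK : Decays K C δ) : Decays (permK Ψ K) C δ := by
  intro x y a b
  rw [permK_apply, ← hr x y]
  exact hK _ _ _ _

/-- [folklore] BI-LOCALISATION TRANSPORT: a kernel bi-localised at `(r p, r q)` relabels to one bi-localised at `(p, q)`, same constants. -/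
theorem biLoc_permK {Ψ : LegPerm D F} (hr : ∀ x y : Fin D → ℤ, l1 (Ψ.r x - Ψ.r y) = l1 (x - y)) {K : MKer D F}
    {p q : Fin D → ℤ} {C δ : ℝ} (hK : BiLoc K (Ψ.r p) (Ψ.r q) C δ) : BiLoc (permK Ψ K) p q C δ := by
  intro x y a b
  rw [permK_apply, ← hr x p, ← hr y q]
  exact hK _ _ _ _

variable [Fintype F]

/-- [folklore] **COMPOSITION COMMUTES WITH RELABELLING, UNCONDITIONALLY**: `(Ψ·A) ∘ (Ψ·K) = Ψ·(A ∘ K)` — the middle leg's finite type sum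
is re-indexed by `π` and its lattice `tsum` by `r` (both re-indexings are unconditional). -/
theorem comp_permK (Ψ : LegPerm D F) (A K : MKer D F) : comp (permK Ψ A) (permK Ψ K) = permK Ψ (comp A K) := by
  funext x z a b
  calc comp (permK Ψ A) (permK Ψ K) x z a b
      = ∑' y, ∑ f, A (Ψ.r x) (Ψ.r y) (Ψ.π a) (Ψ.π f) * K (Ψ.r y) (Ψ.r z) (Ψ.π f) (Ψ.π b) := rfl
    _ = ∑' y, ∑ f, A (Ψ.r x) (Ψ.r y) (Ψ.π a) f * K (Ψ.r y) (Ψ.r z) f (Ψ.π b) :=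
        tsum_congr fun y => Equiv.sum_comp Ψ.π (fun f => A (Ψ.r x) (Ψ.r y) (Ψ.π a) f * K (Ψ.r y) (Ψ.r z) f (Ψ.π b))
    _ = ∑' y, ∑ f, A (Ψ.r x) y (Ψ.π a) f * K y (Ψ.r z) f (Ψ.π b) :=
        Equiv.tsum_eq Ψ.r (fun y => ∑ f, A (Ψ.r x) y (Ψ.π a) f * K y (Ψ.r z) f (Ψ.π b))
    _ = permK Ψ (comp A K) x z a b := rfl

/-- [folklore] **THE TRACE IS RELABELLING-INVARIANT, UNCONDITIONALLY**: `tr (Ψ·M) = tr M`. -/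
theorem tr_permK (Ψ : LegPerm D F) (M : MKer D F) : tr (permK Ψ M) = tr M := by
  calc tr (permK Ψ M) = ∑' x, ∑ a, M (Ψ.r x) (Ψ.r x) (Ψ.π a) (Ψ.π a) := rfl
    _ = ∑' x, ∑ a, M (Ψ.r x) (Ψ.r x) a a := tsum_congr fun x => Equiv.sum_comp Ψ.π (fun a => M (Ψ.r x) (Ψ.r x) a a)
    _ = ∑' x, ∑ a, M x x a a := Equiv.tsum_eq Ψ.r (fun x => ∑ a, M x x a a)
    _ = tr M := rfl

/-- [folklore] **THE BUBBLE IS RELABELLING-INVARIANT**: `bubble (Ψ·A) (Ψ·V) (Ψ·W) = bubble A V W` (unconditional). -/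
theorem bubble_permK (Ψ : LegPerm D F) (A V W : MKer D F) : bubble (permK Ψ A) (permK Ψ V) (permK Ψ W) = bubble A V W := by
  unfold ExpKernelCalculus.bubble
  rw [comp_permK, comp_permK, comp_permK, tr_permK]

/-- [folklore] **THE TADPOLE IS RELABELLING-INVARIANT**: `tadpole (Ψ·A) (Ψ·W₂) = tadpole A W₂` (unconditional). -/
theorem tadpole_permK (Ψ : LegPerm D F) (A W₂ : MKer D F) : tadpole (permK Ψ A) (permK Ψ W₂) = tadpole A W₂ := by
  unfold ExpKernelCalculus.tadpole
  rw [comp_permK, tr_permK]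

/-! ## §3 Invariance of the resolvent Hessian kernel under a symmetry of its ingredients -/

/-- [folklore] **INVARIANCE OF THE RESOLVENT HESSIAN KERNEL.** If the resolvent is relabelling-invariant (`Ψ·A = A`) and the vertex families at
the image bonds — directions moved by `τ`, base points by `ρ` with `ρ 0 = 0` — are the relabelled vertex families
(`V (τ μ) (ρ y) = Ψ·(V μ y)`, `W (τ μ) (ρ y) (τ ν) (ρ y') = Ψ·(W μ y ν y')`), then
`hessKer A V W (τ μ) (τ ν) (ρ z) = hessKer A V W μ ν z`.  No decay, no block covariance is needed. -/
theorem hessKer_perm (Ψ : LegPerm D F) {A : MKer D F} {V : Fin D → (Fin D → ℤ) → MKer D F}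
    {W : Fin D → (Fin D → ℤ) → Fin D → (Fin D → ℤ) → MKer D F} (hAr : permK Ψ A = A) (τ : Fin D → Fin D)
    (ρ : (Fin D → ℤ) → (Fin D → ℤ)) (hρ0 : ρ 0 = 0) (hVr : ∀ μ y, V (τ μ) (ρ y) = permK Ψ (V μ y))
    (hWr : ∀ μ y ν y', W (τ μ) (ρ y) (τ ν) (ρ y') = permK Ψ (W μ y ν y')) (μ ν : Fin D) (z : Fin D → ℤ) :
    hessKer A V W (τ μ) (τ ν) (ρ z) = hessKer A V W μ ν z := by
  have hW0 : W (τ μ) 0 (τ ν) (ρ z) = permK Ψ (W μ 0 ν z) := by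
    have h := hWr μ 0 ν z
    rwa [hρ0] at h
  have hV0 : V (τ μ) 0 = permK Ψ (V μ 0) := by
    have h := hVr μ 0
    rwa [hρ0] at h
  unfold ExpKernelCalculus.hessKer
  rw [hW0, hV0, hVr]
  conv_lhs => rw [← hAr]
  rw [tadpole_permK, bubble_permK]

end Generic

/-! ## §4 The axis-permutation leg map: field and multiplier legs both relabelled by `σ` -/

section Axis

variable {d : ℕ}

/-- [folklore] **THE AXIS-PERMUTATION LEG MAP** on the fibre `Fin (d+1) ⊕ Fin (d+1)` (field legs `inl κ`, multiplier legs `inr κ`):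
sites by `psite σ`, BOTH leg kinds by `κ ↦ σ κ`. -/
def axisPerm (σ : Equiv.Perm (Fin (d + 1))) : LegPerm (d + 1) (Fin (d + 1) ⊕ Fin (d + 1)) where
  r := psite σ
  π := Equiv.sumCongr σ σ

/-- [folklore] The site map of the axis-permutation leg map. -/
@[simp] theorem axisPerm_r (σ : Equiv.Perm (Fin (d + 1))) (x : Fin (d + 1) → ℤ) : (axisPerm σ).r x = psite σ x := rfl

/-- [folklore] Field legs are relabelled by `σ`. -/
@[simp] theorem axisPerm_π_inl (σ : Equiv.Perm (Fin (d + 1))) (κ : Fin (d + 1)) :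
    (axisPerm σ).π (Sum.inl κ) = Sum.inl (σ κ) := rfl

/-- [folklore] Multiplier legs are relabelled by `σ`. -/
@[simp] theorem axisPerm_π_inr (σ : Equiv.Perm (Fin (d + 1))) (κ : Fin (d + 1)) :
    (axisPerm σ).π (Sum.inr κ) = Sum.inr (σ κ) := rfl

/-- [folklore] Entries of an axis-permuted kernel. -/
theorem permK_axisPerm_apply (σ : Equiv.Perm (Fin (d + 1))) (K : MKer (d + 1) (Fin (d + 1) ⊕ Fin (d + 1)))
    (x z : Fin (d + 1) → ℤ) (a b : Fin (d + 1) ⊕ Fin (d + 1)) :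
    permK (axisPerm σ) K x z a b = K (psite σ x) (psite σ z) ((axisPerm σ).π a) ((axisPerm σ).π b) := rfl

/-- [folklore] The site map of `axisPerm σ` is an `ℓ¹`-isometry (the hypothesis `hr` of `decays_permK` ∕ `biLoc_permK`). -/
theorem axisPerm_l1 (σ : Equiv.Perm (Fin (d + 1))) (x y : Fin (d + 1) → ℤ) :
    l1 ((axisPerm σ).r x - (axisPerm σ).r y) = l1 (x - y) :=
  l1_psite_sub σ x y

/-- [folklore] Axis permutation preserves exponential decay, same constants. -/
theorem decays_permK_axisPerm (σ : Equiv.Perm (Fin (d + 1))) {K : MKer (d + 1) (Fin (d + 1) ⊕ Fin (d + 1))} {C δ : ℝ}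
    (hK : Decays K C δ) : Decays (permK (axisPerm σ) K) C δ :=
  decays_permK (axisPerm_l1 σ) hK

/-- [folklore] Axis permutation transports bi-localisation: localised at `(σ•p, σ•q)` ↦ localised at `(p, q)`. -/
theorem biLoc_permK_axisPerm (σ : Equiv.Perm (Fin (d + 1))) {K : MKer (d + 1) (Fin (d + 1) ⊕ Fin (d + 1))}
    {p q : Fin (d + 1) → ℤ} {C δ : ℝ} (hK : BiLoc K (psite σ p) (psite σ q) C δ) : BiLoc (permK (axisPerm σ) K) p q C δ :=
  biLoc_permK (axisPerm_l1 σ) hK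

/-- [folklore] **SIMULTANEOUS SHIFTS AND AXIS PERMUTATION**: `shiftK v (σ·K) = σ·(shiftK (σ•v) K)`. -/
theorem shiftK_permK_axisPerm (σ : Equiv.Perm (Fin (d + 1))) (v : Fin (d + 1) → ℤ)
    (K : MKer (d + 1) (Fin (d + 1) ⊕ Fin (d + 1))) :
    shiftK v (permK (axisPerm σ) K) = permK (axisPerm σ) (shiftK (psite σ v) K) := rfl

/-- [folklore] … read backwards: an axis-permutation-invariant kernel that is invariant under the coarse shifts `N•t` stays so (bookkeeping
form used by MODULE 2): `shiftK (σ•v) K = K → shiftK v (σ·K) = σ·K`. -/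
theorem shiftK_permK_axisPerm_of_invariant (σ : Equiv.Perm (Fin (d + 1))) {v : Fin (d + 1) → ℤ}
    {K : MKer (d + 1) (Fin (d + 1) ⊕ Fin (d + 1))} (hK : shiftK (psite σ v) K = K) :
    shiftK v (permK (axisPerm σ) K) = permK (axisPerm σ) K := by
  rw [shiftK_permK_axisPerm, hK]

/-- [folklore] **`B12Beta.PermCovariant` OF A RESOLVENT HESSIAN KERNEL FROM THE COVARIANCE OF ITS INGREDIENTS** (any fibre type `F`):
if for every axis permutation `σ` there is a leg relabelling `Ψσ` with `Ψσ·A = A`, `V (σ μ) (σ•y) = Ψσ·(V μ y)` and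
`W (σ μ) (σ•y) (σ ν) (σ•y') = Ψσ·(W μ y ν y')`, then `hessKer A V W (σ μ) (σ ν) (x ∘ σ⁻¹) = hessKer A V W μ ν x` — (1.21) p. 264's
permutation half, VERBATIM as typed in `B12Beta.PermCovariant`.  The three covariances are HYPOTHESES (binders), never facts. -/
theorem permCovariant_hessKer {F : Type*} [Fintype F] {A : MKer D F} {V : Fin D → (Fin D → ℤ) → MKer D F}
    {W : Fin D → (Fin D → ℤ) → Fin D → (Fin D → ℤ) → MKer D F}
    (h : ∀ σ : Equiv.Perm (Fin D), ∃ Ψ : LegPerm D F, permK Ψ A = A ∧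
      (∀ μ y, V (σ μ) (psite σ y) = permK Ψ (V μ y)) ∧
      (∀ μ y ν y', W (σ μ) (psite σ y) (σ ν) (psite σ y') = permK Ψ (W μ y ν y'))) :
    PermCovariant (hessKer A V W) := by
  intro σ μ ν x
  obtain ⟨Ψ, hA, hV, hW⟩ := h σ
  exact hessKer_perm Ψ hA σ (psite σ) (psite_zero σ) hV hW μ ν x

/-- [folklore] The same for the flipped kernel `z ↦ hessKer A V W μ ν (−z)` (the cell's `flipK`; `σ•(−z) = −(σ•z)`). -/
theorem permCovariant_flip_hessKer {F : Type*} [Fintype F] {A : MKer D F} {V : Fin D → (Fin D → ℤ) → MKer D F}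
    {W : Fin D → (Fin D → ℤ) → Fin D → (Fin D → ℤ) → MKer D F}
    (h : ∀ σ : Equiv.Perm (Fin D), ∃ Ψ : LegPerm D F, permK Ψ A = A ∧
      (∀ μ y, V (σ μ) (psite σ y) = permK Ψ (V μ y)) ∧
      (∀ μ y ν y', W (σ μ) (psite σ y) (σ ν) (psite σ y') = permK Ψ (W μ y ν y'))) :
    PermCovariant (fun μ ν z => hessKer A V W μ ν (-z)) := by
  intro σ μ ν x
  have e : -(x ∘ ⇑σ.symm) = psite σ (-x) := rfl
  show hessKer A V W (σ μ) (σ ν) (-(x ∘ ⇑σ.symm)) = hessKer A V W μ ν (-x)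
  rw [e]
  exact permCovariant_hessKer h σ μ ν (-x)

/-- [folklore] `PermCovariant` is preserved by the flip `z ↦ −z` (bookkeeping: the cell states its rows on `flipK T`). -/
theorem permCovariant_flip {T : Fin D → Fin D → (Fin D → ℤ) → ℝ} (hT : PermCovariant T) :
    PermCovariant (fun μ ν z => T μ ν (-z)) := by
  intro σ μ ν x
  have e : -(x ∘ ⇑σ.symm) = (-x) ∘ ⇑σ.symm := rfl
  show T (σ μ) (σ ν) (-(x ∘ ⇑σ.symm)) = T μ ν (-x)
  rw [e]
  exact hT σ μ ν (-x)

end Axis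

end

end Summit.QuantumFields.BalabanUV.Beta.KernelPermutation
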